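import Literature.MathematicalPhysics.QuantumLattice.GaugeGroups
import HarnessLib

/-!
# The finite-temperature Wilson lattice gauge theory on `ℤ_{L₀} × (ℤ/L)^d` — clean-cone host of
# the elementary objects (sites, links, plaquettes, action, Haar measure, expectations, Polyakov
# loops)

Definition file (D-0014 / D-0026: definitions with bodies and proved API only; NO named fact),
requested as `defn-qcdThermalPartition` (planner `rrepair-QuantumFields-CounterexampleMu-3aa0ba5b`,
cone repair 2026-08-15) by the QCD routes `CounterexampleMustBeHot`, `CentreStabilisedCircle`,
`FemtoStepScaling` of `Summits/QuantumFields/QCD` (and usable by the Yang–Mills thermal routes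
`SmallCircleAnchor`, `ThermalRuler`).

## Why this file exists

The objects below were introduced INSIDE the barrier file
`Literature/Barriers/QuantumFields/FiniteTemperatureDeconfinement.lean` (namespace
`Literature.Barriers.QuantumFields.FiniteTemperature`), next to the unproved named fact
`Literature.Barriers.QuantumFields.FiniteTemperatureDeconfinement` (Borgs–Seiler 1983, Thm. III.7)
and on top of `Literature.MathematicalPhysics.QuantumFieldTheory.YangMillsEuclidean`. Every route
that only needs the finite-temperature lattice, its Wilson action and its Haar expectations had to
import the barrier file and thereby dragged that fact (and the Yang–Mills continuum vocabulary)
into its module import cone. This module re-homes the elementary objects VERBATIM (same names,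
same bodies, same signatures, same proofs) into `Literature.MathematicalPhysics.QuantumLattice`,
importing only `GaugeGroups` (hence `ConstructiveQFTWave0`: the normalised Haar measure
`haarProbability` and its `IsProbabilityMeasure` instance) on top of Mathlib, so that thermal lattice statements can be typed over a clean cone:
`FiniteTemperature.Config 3 Nt Ns (Matrix.specialUnitaryGroup (Fin 3) ℂ)`,
`FiniteTemperature.haar`, `FiniteTemperature.weight ρ β β`, … after
`open Literature.MathematicalPhysics.QuantumLattice`.

## Content (all copied from the barrier file; citations kept)

* `FiniteTemperature.Site d L₀ L = ZMod L₀ × (Fin d → ZMod L)` (time first, periodic in time and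
  space), `FiniteTemperature.Dir d = Option (Fin d)` (`none` = time), `Site.shift`,
  `FiniteTemperature.Config d L₀ L G` (a group element per positively oriented link),
  `plaquette`, `minusAction ρ J_E J_M` (`J_E Σ_{time-like P} Re tr ρ(U_P) + J_M Σ_{space-like P} Re tr ρ(U_P)`),
  the Boltzmann `weight = exp(minusAction)`, the product Haar measure `haar`, the normalised
  `expectation` (a ratio of real integrals);
* the Polyakov loop: `timeHolonomy`, `polyakovLine`, `polyakovTrace ρ`, and the two-point
  function `polyakovCorrelation ρ J_E J_M x = Re ⟨χ(P_0) χ̄(P_x)⟩` (Borgs–Seiler (II.22));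
* PROVED structure: `haar_isProbabilityMeasure`, `continuous_link`, `continuous_plaquette`,
  `continuous_minusAction`, `continuous_weight`, `weight_pos`, `integrable_of_continuous`,
  `partitionFunction_pos` (`Z > 0`, so expectations are genuine averages).

## Not here

The subsequential thermodynamic limits `IsThermodynamicLimit`, long-range order
`HasPolyakovLongRangeOrder`, the technique classes and the Borgs–Seiler fact stay in the barrier
file, which keeps (for now) its own copies of the objects below; the two families of constants
have identical bodies (the `abbrev`s `Site`, `Dir`, `Config` are the same types), and the barrier
file can later be re-pointed at this host by `export` without changing any statement. The QCD
thermal partition function with antiperiodic Wilson quarks built on these objects is the sibling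
`Literature.MathematicalPhysics.QuantumFieldTheory.QCDThermal`.

## References

* C. Borgs, E. Seiler, *Lattice Yang–Mills theory at nonzero temperature and the confinement
  problem*, Commun. Math. Phys. 91 (1983) 329–380, §II.2 (II.2) (p. 332), §II.3 (II.20)–(II.22)
  (pp. 335–337), §III.1 (III.1)–(III.2) (p. 344). [BorgsSeiler1983]
-/

noncomputable section

open MeasureTheory Filter Topology
open scoped ComplexConjugate

namespace Literature.MathematicalPhysics.QuantumLattice

namespace FiniteTemperature

/-! ### The finite-temperature lattice `ℤ_{L₀} × (ℤ/L)^d` and Wilson's action with `J_E`, `J_M` -/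

/-- Sites of the finite-temperature lattice: a time coordinate in `ℤ_{L₀}` ("We impose periodic
boundary conditions in time") and a spatial site of the periodic box `(ℤ/L)^d`. [cite: BorgsSeiler1983, §II.3 (II.20) (pp. 335–336)] -/
abbrev Site (d L₀ L : ℕ) : Type := ZMod L₀ × (Fin d → ZMod L)

/-- Lattice directions: `none` is the time direction, `some i` the spatial direction `i`. [folklore] -/
abbrev Dir (d : ℕ) : Type := Option (Fin d)

variable {d L₀ L : ℕ}

/-- The neighbouring site `x + e_μ` (periodically in time and in space). [folklore] -/
def Site.shift (x : Site d L₀ L) : Dir d → Site d L₀ L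
  | none => (x.1 + 1, x.2)
  | some i => (x.1, x.2 + Pi.single i 1)

/-- Configurations: a group element on every positively oriented link `(x, μ)`. [folklore] -/
abbrev Config (d L₀ L : ℕ) (G : Type*) : Type _ := Site d L₀ L × Dir d → G

variable {G : Type*} [Group G] {N : ℕ}

/-- Plaquette holonomy `U(x,μ) U(x+e_μ,ν) U(x+e_ν,μ)⁻¹ U(x,ν)⁻¹` (`g_{∂P}`, "the ordered
product"). [cite: BorgsSeiler1983, §II.2 (II.2) (p. 332)] -/
def plaquette (U : Config d L₀ L G) (x : Site d L₀ L) (μ ν : Dir d) : G :=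
  U (x, μ) * U (x.shift μ, ν) * (U (x.shift ν, μ))⁻¹ * (U (x, ν))⁻¹

variable (ρ : G →* Matrix (Fin N) (Fin N) ℂ)

/-- Minus the finite-temperature Wilson action: `J_E Σ Re χ(g_{∂P})` over the plaquettes
containing the time direction (based at `x`, directions `(0, i)`) plus `J_M Σ Re χ(g_{∂P})` over
the spatial plaquettes (directions `(i, j)`, `i < j`), `χ = tr ρ`. (Borgs–Seiler's `S_P^W` is
`−J_M Re χ(g_{∂P})` for `P` spatial and `−J_E Re χ(g_{∂P})` if `P` contains the time direction;
cf. the one-layer form (III.1); constant normalisations of `J_E, J_M` are immaterial, thresholds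
being existential.) [cite: BorgsSeiler1983, §II.3 (II.20) (pp. 335–336); §III.1 (III.1)–(III.2) (p. 344)] -/
def minusAction [NeZero L₀] [NeZero L] (JE JM : ℝ) (U : Config d L₀ L G) : ℝ :=
  JE * ∑ x : Site d L₀ L, ∑ i : Fin d, (ρ (plaquette U x none (some i))).trace.re +
  JM * ∑ x : Site d L₀ L, ∑ p : {p : Fin d × Fin d // p.1 < p.2},
    (ρ (plaquette U x (some p.1.1) (some p.1.2))).trace.re

/-- The Boltzmann weight `e^{−S_W}`. [cite: BorgsSeiler1983, §II.3 (II.20) (pp. 335–336)] -/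
def weight [NeZero L₀] [NeZero L] (JE JM : ℝ) (U : Config d L₀ L G) : ℝ :=
  Real.exp (minusAction ρ JE JM U)

variable [TopologicalSpace G] [IsTopologicalGroup G] [CompactSpace G] [MeasurableSpace G]
  [BorelSpace G]

variable (d L₀ L G) in
/-- The a-priori measure `∏_{links} dg` (product of normalised Haar measures, the tree's
`haarProbability`). [cite: BorgsSeiler1983, §II.3 (II.20)–Lemma II.3 (p. 336)] -/
def haar [NeZero L₀] [NeZero L] : Measure (Config d L₀ L G) :=
  Measure.pi fun _ : Site d L₀ L × Dir d => Literature.MathematicalPhysics.QuantumFieldTheory.haarProbability G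

/-- Expectations `⟨F⟩ = ∫ F e^{−S_W} ∏dg / ∫ e^{−S_W} ∏dg` in the periodic box (a ratio of real
integrals; a genuine normalised average since `Z > 0`, `partitionFunction_pos`). [cite: BorgsSeiler1983, §II.3 (II.22) (p. 337)] -/
def expectation [NeZero L₀] [NeZero L] (JE JM : ℝ) (F : Config d L₀ L G → ℝ) : ℝ :=
  (∫ U, F U * weight ρ JE JM U ∂haar d L₀ L G) / (∫ U, weight ρ JE JM U ∂haar d L₀ L G)

omit [TopologicalSpace G] [IsTopologicalGroup G] [CompactSpace G] [MeasurableSpace G]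
  [BorelSpace G] in
/-- Holonomy of `n` forward steps in the time direction from `y` (ordered product). [folklore] -/
def timeHolonomy (U : Config d L₀ L G) : ℕ → Site d L₀ L → G
  | 0, _ => 1
  | n + 1, y => U (y, none) * timeHolonomy U n (y.shift none)

/-- The Polyakov loop `g_{L_x}`: the holonomy of the closed loop winding once around the time
circle at the spatial site `x` (ordered product of the `L₀` time-like links, starting at time
`0`; "closed because of the periodic boundary conditions"). [cite: BorgsSeiler1983, §II.3 Lemma II.4 and Remark 1 (p. 336)] -/
def polyakovLine (U : Config d L₀ L G) (x : Fin d → ZMod L) : G :=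
  timeHolonomy U L₀ ((0 : ZMod L₀), x)

/-- The traced Polyakov loop `χ(g_{L_x}) = tr ρ(g_{L_x})` ("variously called a Polyakov loop,
thermal Wilson loop, Wilson line"). [cite: BorgsSeiler1983, §II.3 Lemma II.4, Remark 1 (p. 336)] -/
def polyakovTrace (U : Config d L₀ L G) (x : Fin d → ZMod L) : ℂ :=
  (ρ (polyakovLine U x)).trace

/-- The Polyakov-loop two-point function `G_L(x) = Re ⟨χ_q(g_{L_0}) χ̄_q(g_{L_x})⟩` in the
periodic box of spatial side `L` ((II.22); the expectation is real by the symmetry `U ↦ Ū`, the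
real part is taken for definiteness). [cite: BorgsSeiler1983, §II.3 (II.22) (p. 337)] -/
def polyakovCorrelation [NeZero L₀] [NeZero L] (JE JM : ℝ) (x : Fin d → ZMod L) : ℝ :=
  expectation ρ JE JM fun U : Config d L₀ L G =>
    (polyakovTrace ρ U 0 * conj (polyakovTrace ρ U x)).re

/-! ### Non-degeneracy: continuity and `Z > 0` -/

/-- The a-priori measure is a probability measure. [folklore] -/
instance haar_isProbabilityMeasure [NeZero L₀] [NeZero L] :
    IsProbabilityMeasure (haar d L₀ L G) := by
  unfold haar; infer_instance

omit [Group G] [IsTopologicalGroup G] [CompactSpace G] [MeasurableSpace G] [BorelSpace G] in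
/-- Each link variable depends continuously on the configuration. [folklore] -/
theorem continuous_link (e : Site d L₀ L × Dir d) : Continuous fun U : Config d L₀ L G => U e :=
  continuous_apply e

omit [CompactSpace G] [MeasurableSpace G] [BorelSpace G] in
/-- Plaquette holonomies are continuous. [folklore] -/
theorem continuous_plaquette (x : Site d L₀ L) (μ ν : Dir d) :
    Continuous fun U : Config d L₀ L G => plaquette U x μ ν := by
  unfold plaquette
  exact (((continuous_link _).mul (continuous_link _)).mul (continuous_link _).inv).mul
    (continuous_link _).inv

omit [CompactSpace G] [MeasurableSpace G] [BorelSpace G] in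
/-- The action is continuous for a continuous representation. [folklore] -/
theorem continuous_minusAction [NeZero L₀] [NeZero L] (hρ : Continuous ρ) (JE JM : ℝ) :
    Continuous fun U : Config d L₀ L G => minusAction ρ JE JM U := by
  unfold minusAction
  have htr : ∀ (x : Site d L₀ L) (μ ν : Dir d),
      Continuous fun U : Config d L₀ L G => (ρ (plaquette U x μ ν)).trace.re := fun x μ ν =>
    Complex.continuous_re.comp ((Continuous.matrix_trace (hρ.comp (continuous_plaquette x μ ν))))
  refine (continuous_const.mul ?_).add (continuous_const.mul ?_)
  · exact continuous_finsetSum _ fun x _ => continuous_finsetSum _ fun i _ => htr x _ _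
  · exact continuous_finsetSum _ fun x _ => continuous_finsetSum _ fun p _ => htr x _ _

omit [CompactSpace G] [MeasurableSpace G] [BorelSpace G] in
/-- The Boltzmann weight is continuous. [folklore] -/
theorem continuous_weight [NeZero L₀] [NeZero L] (hρ : Continuous ρ) (JE JM : ℝ) :
    Continuous fun U : Config d L₀ L G => weight ρ JE JM U :=
  Real.continuous_exp.comp (continuous_minusAction ρ hρ JE JM)

omit [TopologicalSpace G] [IsTopologicalGroup G] [CompactSpace G] [MeasurableSpace G]
  [BorelSpace G] in
/-- The Boltzmann weight is positive. [folklore] -/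
theorem weight_pos [NeZero L₀] [NeZero L] (JE JM : ℝ) (U : Config d L₀ L G) :
    0 < weight ρ JE JM U := Real.exp_pos _

variable [SecondCountableTopology G]

/-- Continuous real functions on the (compact) configuration space are integrable. [folklore] -/
theorem integrable_of_continuous [NeZero L₀] [NeZero L] {f : Config d L₀ L G → ℝ}
    (hf : Continuous f) : Integrable f (haar d L₀ L G) :=
  hf.integrable_of_hasCompactSupport
    (IsCompact.of_isClosed_subset isCompact_univ (isClosed_tsupport _) (Set.subset_univ _))

/-- **`Z > 0`**: the partition function of the periodic box is positive. [cite: BorgsSeiler1983, §II.3 Lemma II.3 (p. 336)] -/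
theorem partitionFunction_pos [NeZero L₀] [NeZero L] (hρ : Continuous ρ) (JE JM : ℝ) :
    0 < ∫ U, weight ρ JE JM U ∂haar d L₀ L G := by
  unfold weight
  exact integral_exp_pos (integrable_of_continuous (continuous_weight ρ hρ JE JM))

/-- Expectations are normalised: `⟨1⟩ = 1` (the partition function is positive, hence non-zero).
[folklore] -/
theorem expectation_one [NeZero L₀] [NeZero L] (hρ : Continuous ρ) (JE JM : ℝ) :
    expectation (d := d) (L₀ := L₀) (L := L) (G := G) ρ JE JM (fun _ => 1) = 1 := by
  unfold expectation
  simp only [one_mul]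
  exact div_self (partitionFunction_pos ρ hρ JE JM).ne'

end FiniteTemperature

end Literature.MathematicalPhysics.QuantumLattice
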